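import Literature.NumberTheory.LFunctions.SemimultiplicativeMoebiusChain
import Literature.NumberTheory.LFunctions.SemimultiplicativeMoebiusCircle
import HarnessLib

/-!
# Konieczny 2020, §7 (structured sequences), I: approximate multiplicativity and linearisation

Topic `Literature/NumberTheory/LFunctions`. Everything in this file is PROVED. This is the first
half of the multiplicative rendering of Proposition 7.1 of J. Konieczny, Monatsh. Math. 192
(2020) (arXiv:1808.06196, §7).  Setting (all of it hypotheses of the theorems below): `f` is
unimodular and `q`-semimultiplicative with gap `≤ r`; `p' < p` with `p` coprime to `q`,
`p < q^B`, and `t ≥ 1` with `q^{B+r} p'^t < p^t`; a window of digit positions `W = [A, A+ℓ)`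
and `ρ ≥ 0` such that

  `‖f(pn) - f(p'n)‖ ≤ ρ` whenever `supp(n) ⊆ W`, i.e. `q^A ∣ n` and `n < q^{A+ℓ}`       (Hρ)

(in the paper: `‖ψ(n) - β‖ ≤ ε` for `ψ(n) = φ(pn) - φ(p'n)`, `f = e(φ)`; `β = 0` w.l.o.g.).  With
the margin `κ = r + tB`:

* `norm_sub_drop_le` — `‖f(x) - f(x p'^j / p^j)‖ ≤ jρ` when `p^j ∣ x`, `supp x ⊆ W` (the chain
  `x, x p'/p, …` used in the proof of Lemma 7.2);
* `approx_mul` — **Lemma 7.2**: `‖f(n+m) - f(n) f(m)‖ ≤ 3tρ` whenever `q^l ∣ n`, `m < q^{l+B}`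
  and `n, m, n+m` are supported in the inner window `[A+κ, A+ℓ-κ)` (the `p^t`-divisibility trick:
  pad `m` below and `n` above by `Δ`'s making them divisible by `p^t`, pass to `(p'/p)^t`-multiples
  whose supports are separated, and use quasimultiplicativity);
* `approx_pow` — `‖f(x q^l) - f(q^l)^x‖ ≤ 3tρ x` for `x ≤ q` (eq. (19:99) of the paper);
* `approx_char` — with `w` from the shadowing lemma (`‖f(q^l) - w^{q^l}‖ ≤ 12tqρ`, eq. (19:98)),
  `‖f(n) - w^n‖ ≤ 18 t q² · len · ρ` for `n` supported on `len` consecutive core positions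
  (eq. (19:97): `‖φ(n) - nα‖ ≪ ε s_q(n)`).
-/

noncomputable section

open Finset
open scoped ComplexConjugate

namespace Literature.NumberTheory.LFunctions

namespace Konieczny

/-! ## Small helpers -/

/-- `‖ab - cd‖ ≤ ‖a - c‖ + ‖b - d‖` when `‖a‖, ‖d‖ ≤ 1`. [folklore] -/
theorem norm_mul_sub_mul_le {a b c d : ℂ} (ha : ‖a‖ ≤ 1) (hd : ‖d‖ ≤ 1) :
    ‖a * b - c * d‖ ≤ ‖a - c‖ + ‖b - d‖ := by
  have : a * b - c * d = a * (b - d) + (a - c) * d := by ring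
  rw [this]
  calc _ ≤ ‖a * (b - d)‖ + ‖(a - c) * d‖ := norm_add_le _ _
    _ = ‖a‖ * ‖b - d‖ + ‖a - c‖ * ‖d‖ := by rw [norm_mul, norm_mul]
    _ ≤ 1 * ‖b - d‖ + ‖a - c‖ * 1 := by gcongr
    _ = ‖a - c‖ + ‖b - d‖ := by ring

/-- If `d ∣ a`, `d ∣ b` and `a < b` then `a + d ≤ b`. [folklore] -/
theorem add_le_of_dvd_of_lt {a b d : ℕ} (ha : d ∣ a) (hb : d ∣ b) (hab : a < b) : a + d ≤ b := by
  obtain ⟨a', rfl⟩ := ha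
  obtain ⟨b', rfl⟩ := hb
  have : a' < b' := lt_of_mul_lt_mul_left hab (Nat.zero_le d)
  nlinarith

/-- Padding to a multiple of `p^t`: for `q` coprime to `p` there is `δ < p^t` with
`p^t ∣ m + δ q^a`. [folklore] -/
theorem exists_pad {q p : ℕ} (hcop : Nat.Coprime q p) {t : ℕ} (hpt : 1 < p ^ t) (a m : ℕ) :
    ∃ δ : ℕ, δ < p ^ t ∧ p ^ t ∣ m + δ * q ^ a := by
  have hcop' : Nat.Coprime (q ^ a) (p ^ t) := (hcop.pow_left a).pow_right t
  obtain ⟨δ, hδ, hδeq⟩ := Nat.exists_mul_mod_eq_of_coprime (p ^ t - m % p ^ t) hcop' (by omega)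
  refine ⟨δ, hδ, ?_⟩
  rw [Nat.dvd_iff_mod_eq_zero, Nat.add_mod, mul_comm δ, hδeq]
  have hP : 0 < p ^ t := by omega
  have hm : m % p ^ t < p ^ t := Nat.mod_lt _ hP
  rcases Nat.eq_zero_or_pos (m % p ^ t) with h0 | h0
  · rw [h0, Nat.sub_zero, Nat.mod_self, add_zero, Nat.zero_mod]
  · rw [Nat.mod_eq_of_lt (by omega : p ^ t - m % p ^ t < p ^ t),
      show m % p ^ t + (p ^ t - m % p ^ t) = p ^ t by omega, Nat.mod_self]

/-! ## The chain `x, x p'/p, x p'²/p², …` -/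

/-- **The `(p'/p)`-chain**: under (Hρ), if `p^j ∣ x` and `supp x ⊆ [A, A+ℓ)` then
`‖f(x) - f(x/p^j · p'^j)‖ ≤ jρ` (each step replaces one factor `p` by `p'` at a number supported in
the window). [cite: Konieczny2020, Lemma 7.2] -/
theorem norm_sub_drop_le {q : ℕ} {f : ℕ → ℂ} {p p' A ℓ : ℕ} (hp'p : p' < p) (hcop : Nat.Coprime q p)
    {ρ : ℝ} (Hρ : ∀ n, q ^ A ∣ n → n < q ^ (A + ℓ) → ‖f (p * n) - f (p' * n)‖ ≤ ρ) :
    ∀ j x : ℕ, p ^ j ∣ x → q ^ A ∣ x → x < q ^ (A + ℓ) →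
      ‖f x - f (x / p ^ j * p' ^ j)‖ ≤ j * ρ := by
  have hp : 0 < p := by omega
  intro j
  induction j with
  | zero => intro x _ _ _; simp
  | succ j ih =>
      intro x hpx hqx hxlt
      obtain ⟨y, rfl⟩ : p ∣ x := dvd_trans (dvd_pow_self p (Nat.succ_ne_zero j)) hpx
      -- `x = p y`; `q^A ∣ y`, `p^j ∣ y`
      have hqy : q ^ A ∣ y := (hcop.pow_left A).dvd_of_dvd_mul_left hqx
      have hpy : p ^ j ∣ y := by
        rw [pow_succ, mul_comm (p ^ j) p] at hpx
        exact Nat.dvd_of_mul_dvd_mul_left hp hpx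
      have hylt : y < q ^ (A + ℓ) := lt_of_le_of_lt (Nat.le_mul_of_pos_left y hp) hxlt
      have hp'y : p' * y < q ^ (A + ℓ) :=
        lt_of_le_of_lt (Nat.mul_le_mul_right y hp'p.le) hxlt
      have h1 := Hρ y hqy hylt
      have h2 := ih (p' * y) (dvd_mul_of_dvd_right hpy _) (dvd_mul_of_dvd_right hqy _) hp'y
      have heq : p * y / p ^ (j + 1) * p' ^ (j + 1) = p' * y / p ^ j * p' ^ j := by
        obtain ⟨z, rfl⟩ := hpy
        rw [pow_succ, show p * (p ^ j * z) = z * (p ^ j * p) by ring, Nat.mul_div_cancel _ (by positivity),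
          show p' * (p ^ j * z) = (p' * z) * p ^ j by ring, Nat.mul_div_cancel _ (by positivity), pow_succ]
        ring
      rw [heq]
      calc ‖f (p * y) - f (p' * y / p ^ j * p' ^ j)‖
          ≤ ‖f (p * y) - f (p' * y)‖ + ‖f (p' * y) - f (p' * y / p ^ j * p' ^ j)‖ :=
            norm_sub_le_norm_sub_add_norm_sub _ _ _
        _ ≤ ρ + j * ρ := add_le_add h1 h2
        _ = (j + 1 : ℕ) * ρ := by push_cast; ring

/-! ## Lemma 7.2: approximate multiplicativity with overlapping supports -/

/-- **Konieczny 2020, Lemma 7.2** (multiplicative form).  Let `f` be unimodular and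
`q`-semimultiplicative with gap `≤ r`; `p' < p`, `0 < p'`, `p` coprime to `q`, `p < q^B`, `t ≥ 1`
with `q^{B+r} p'^t < p^t`; put `κ = r + tB` and assume (Hρ) on `W = [A, A+ℓ)` with `2κ ≤ ℓ`.
If `A + κ ≤ l ≤ A + ℓ - κ`, `q^l ∣ n`, `q^{A+κ} ∣ m`, `m < q^{l+B}` and `n, n + m < q^{A+ℓ-κ}`, then
`‖f(n + m) - f(n) f(m)‖ ≤ 3 t ρ`.  (Paper: `φ(n+m) = φ(n) + φ(m) + O(ε)`.)
[cite: Konieczny2020, Lemma 7.2] -/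
theorem approx_mul {q r : ℕ} (hq : 2 ≤ q) {f : ℕ → ℂ} (hf : IsSemimultiplicative q r f)
    (hf1 : ∀ n, ‖f n‖ = 1) {p p' t B A ℓ : ℕ} (hp'p : p' < p) (hp'0 : 0 < p')
    (hcop : Nat.Coprime q p) (hB : p < q ^ B) (ht0 : 0 < t) (ht : q ^ (B + r) * p' ^ t < p ^ t)
    {ρ : ℝ} (Hρ : ∀ n, q ^ A ∣ n → n < q ^ (A + ℓ) → ‖f (p * n) - f (p' * n)‖ ≤ ρ)
    (hℓ : 2 * (r + t * B) ≤ ℓ) {n m l : ℕ} (hl : A + (r + t * B) ≤ l)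
    (hlℓ : l ≤ A + ℓ - (r + t * B)) (hn : q ^ l ∣ n) (hnlt : n < q ^ (A + ℓ - (r + t * B)))
    (hm : q ^ (A + (r + t * B)) ∣ m) (hmlt : m < q ^ (l + B))
    (hnm : n + m < q ^ (A + ℓ - (r + t * B))) :
    ‖f (n + m) - f n * f m‖ ≤ 3 * t * ρ := by
  -- notation and basic sizes
  have hqpos : 0 < q := by omega
  have hp : 1 < p := by omega
  have hQM := isQuasimult hq hf
  set κ := r + t * B with hκ
  have hpt1 : 1 < p ^ t := Nat.one_lt_pow ht0.ne' hp
  have hptq : p ^ t ≤ q ^ (t * B) := by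
    have : p ^ t < (q ^ B) ^ t := Nat.pow_lt_pow_left hB ht0.ne'
    rw [← pow_mul, mul_comm] at this
    exact this.le
  have hκℓ : κ ≤ ℓ := by omega
  set U := A + ℓ - κ with hU                      -- top of the inner window
  have hUeq : U + κ = A + ℓ := by omega
  have hlU : l ≤ U := hlℓ
  have hAκl : A + κ ≤ l := hl
  -- the paddings
  obtain ⟨δm, hδm, hpm⟩ := exists_pad hcop hpt1 A m
  obtain ⟨δn, hδn, hpn⟩ := exists_pad hcop hpt1 (U + r) n
  set Δm := δm * q ^ A with hΔm
  set Δn := δn * q ^ (U + r) with hΔn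
  set mt := m + Δm with hmt
  set nt := n + Δn with hnt
  have hΔmlt : Δm < q ^ (A + (κ - r)) := by
    calc Δm < p ^ t * q ^ A := by rw [hΔm]; exact Nat.mul_lt_mul_of_pos_right hδm (pow_pos hqpos A)
      _ ≤ q ^ (t * B) * q ^ A := Nat.mul_le_mul_right _ hptq
      _ = q ^ (A + (κ - r)) := by rw [← pow_add, hκ, Nat.add_sub_cancel_left, add_comm]
  have hκr : A + (κ - r) + r = A + κ := by omega
  -- divisibilities
  have hmAκ : q ^ (A + κ) ∣ m := hm
  have hnAκ : q ^ (A + κ) ∣ n := dvd_trans (pow_dvd_pow q hAκl) hn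
  have hqAm : q ^ A ∣ m := dvd_trans (pow_dvd_pow q (Nat.le_add_right A κ)) hmAκ
  have hqAn : q ^ A ∣ n := dvd_trans (pow_dvd_pow q (Nat.le_add_right A κ)) hnAκ
  have hqAΔm : q ^ A ∣ Δm := dvd_mul_left _ _
  have hqAΔn : q ^ A ∣ Δn := dvd_mul_of_dvd_right (pow_dvd_pow q (by omega)) _
  have hqlΔn : q ^ l ∣ Δn := dvd_mul_of_dvd_right (pow_dvd_pow q (by omega)) _
  -- sizes of the padded numbers
  have hmtlt : mt < q ^ (l + B) := by
    have h1 : m + q ^ (A + κ) ≤ q ^ (l + B) :=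
      add_le_of_dvd_of_lt hmAκ (pow_dvd_pow q (by omega)) hmlt
    have h2 : Δm < q ^ (A + κ) := lt_of_lt_of_le hΔmlt (Nat.pow_le_pow_right hqpos (by omega))
    rw [hmt]; omega
  have hlB : l + B ≤ A + ℓ := by
    have : B ≤ κ := by rw [hκ]; nlinarith
    omega
  have hQtop : p ^ t * q ^ (U + r) ≤ q ^ (A + ℓ) := by
    calc p ^ t * q ^ (U + r) ≤ q ^ (t * B) * q ^ (U + r) := Nat.mul_le_mul_right _ hptq
      _ = q ^ (A + ℓ) := by rw [← pow_add]; congr 1; omega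
  have hntlt : nt < q ^ (A + ℓ) := by
    have h1 : n < q ^ (U + r) := lt_of_lt_of_le hnlt (Nat.pow_le_pow_right hqpos (by omega))
    have h2 : Δn + q ^ (U + r) ≤ p ^ t * q ^ (U + r) := by
      rw [hΔn, ← Nat.succ_mul]; exact Nat.mul_le_mul_right _ hδn
    rw [hnt]; omega
  have hnmΔ : n + m + Δm < q ^ U := by
    have h1 : n + m + q ^ (A + κ) ≤ q ^ U :=
      add_le_of_dvd_of_lt (dvd_add hnAκ hmAκ) (pow_dvd_pow q (by omega)) hnm
    have h2 : Δm < q ^ (A + κ) := lt_of_lt_of_le hΔmlt (Nat.pow_le_pow_right hqpos (by omega))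
    omega
  have hsumlt : nt + mt < q ^ (A + ℓ) := by
    have h1 : n + m + Δm < q ^ (U + r) := lt_of_lt_of_le hnmΔ (Nat.pow_le_pow_right hqpos (by omega))
    have h2 : Δn + q ^ (U + r) ≤ p ^ t * q ^ (U + r) := by
      rw [hΔn, ← Nat.succ_mul]; exact Nat.mul_le_mul_right _ hδn
    have : nt + mt = Δn + (n + m + Δm) := by rw [hnt, hmt]; ring
    rw [this]; omega
  -- (s1)-(s3): exact factorisations by quasimultiplicativity
  have s1 : f mt = f m * f Δm := by
    rw [hmt]; exact hQM (A + (κ - r)) m Δm hΔmlt (by rw [hκr]; exact hmAκ)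
  have s2 : f nt = f Δn * f n := by
    rw [hnt, add_comm]; exact hQM U Δn n hnlt (dvd_mul_left _ _)
  have s3 : f (nt + mt) = f Δn * (f (n + m) * f Δm) := by
    have h1 : f (n + m + Δm) = f (n + m) * f Δm :=
      hQM (A + (κ - r)) (n + m) Δm hΔmlt (by rw [hκr]; exact dvd_add hnAκ hmAκ)
    have h2 : f (Δn + (n + m + Δm)) = f Δn * f (n + m + Δm) := hQM U Δn _ hnmΔ (dvd_mul_left _ _)
    have : nt + mt = Δn + (n + m + Δm) := by rw [hnt, hmt]; ring
    rw [this, h2, h1]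
  -- (s4)-(s5): pass to `(p'/p)^t`-multiples
  have hpmt : p ^ t ∣ mt := by rw [hmt, hΔm]; exact hpm
  have hpnt : p ^ t ∣ nt := by rw [hnt, hΔn]; exact hpn
  set mt' := mt / p ^ t * p' ^ t with hmt'
  set nt' := nt / p ^ t * p' ^ t with hnt'
  have hdrop := norm_sub_drop_le hp'p hcop Hρ t
  have d1 : ‖f mt - f mt'‖ ≤ t * ρ :=
    hdrop mt hpmt (dvd_add hqAm hqAΔm) (lt_of_lt_of_le hmtlt (Nat.pow_le_pow_right hqpos hlB))
  have d2 : ‖f nt - f nt'‖ ≤ t * ρ := hdrop nt hpnt (dvd_add hqAn hqAΔn) hntlt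
  have d3 : ‖f (nt + mt) - f (nt' + mt')‖ ≤ t * ρ := by
    have h := hdrop (nt + mt) (dvd_add hpnt hpmt) (dvd_add (dvd_add hqAn hqAΔn) (dvd_add hqAm hqAΔm))
      hsumlt
    rwa [Nat.add_div_of_dvd_right hpnt, add_mul] at h
  -- (s6): the supports of `nt'` and `mt'` are separated
  have hmt'lt : mt' < q ^ (l - r) := by
    have hlr : r ≤ l := by omega
    have hppos : 0 < p ^ t := by omega
    have key : mt' * p ^ t < q ^ (l - r) * p ^ t := by
      calc mt' * p ^ t = mt * p' ^ t := by
            rw [hmt', mul_assoc, mul_comm (p' ^ t), ← mul_assoc, Nat.div_mul_cancel hpmt]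
        _ < q ^ (l + B) * p' ^ t := Nat.mul_lt_mul_of_pos_right hmtlt (pow_pos hp'0 t)
        _ = q ^ (l - r) * (q ^ (B + r) * p' ^ t) := by
            rw [← mul_assoc, ← pow_add]; congr 2; omega
        _ ≤ q ^ (l - r) * p ^ t := Nat.mul_le_mul_left _ ht.le
    exact lt_of_mul_lt_mul_right key (Nat.zero_le _)
  have hnt'dvd : q ^ (l - r + r) ∣ nt' := by
    rw [Nat.sub_add_cancel (by omega : r ≤ l), hnt']
    have hql : q ^ l ∣ nt := dvd_add hn hqlΔn
    have hcop' : Nat.Coprime (q ^ l) (p ^ t) := (hcop.pow_left l).pow_right t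
    obtain ⟨c, hc⟩ : q ^ l * p ^ t ∣ nt := hcop'.mul_dvd_of_dvd_of_dvd hql hpnt
    rw [hc, show q ^ l * p ^ t * c = (q ^ l * c) * p ^ t by ring, Nat.mul_div_cancel _ (by omega)]
    exact dvd_mul_of_dvd_left (dvd_mul_right _ _) _
  have s6 : f (nt' + mt') = f nt' * f mt' := hQM (l - r) nt' mt' hmt'lt hnt'dvd
  -- (s7): assemble
  have u1 : ‖f Δn‖ = 1 := hf1 _
  have u2 : ‖f Δm‖ = 1 := hf1 _
  have e1 : ‖f nt' * f mt' - f nt * f mt‖ ≤ 2 * t * ρ := by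
    calc _ ≤ ‖f nt' - f nt‖ + ‖f mt' - f mt‖ := norm_mul_sub_mul_le (hf1 _).le (hf1 _).le
      _ ≤ t * ρ + t * ρ := by rw [norm_sub_rev, norm_sub_rev (f mt')]; exact add_le_add d2 d1
      _ = 2 * t * ρ := by ring
  have e2 : ‖f (nt + mt) - f nt * f mt‖ ≤ 3 * t * ρ := by
    calc ‖f (nt + mt) - f nt * f mt‖
        ≤ ‖f (nt + mt) - f (nt' + mt')‖ + ‖f (nt' + mt') - f nt * f mt‖ :=
          norm_sub_le_norm_sub_add_norm_sub _ _ _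
      _ ≤ t * ρ + 2 * t * ρ := by
          refine add_le_add d3 ?_
          rw [s6]; exact e1
      _ = 3 * t * ρ := by ring
  rw [s3, s2, s1] at e2
  have : f Δn * (f (n + m) * f Δm) - f Δn * f n * (f m * f Δm) =
      f Δn * (f (n + m) - f n * f m) * f Δm := by ring
  rw [this, norm_mul, norm_mul, u1, u2, one_mul, mul_one] at e2
  exact e2

/-! ## Linearisation: powers, and the character `n ↦ w^n` -/

/-- **Powers** (eq. (19:99) of Konieczny 2020): under the hypotheses of `approx_mul`, for a
position `l` with `A + κ ≤ l` and `l + 2 ≤ A + ℓ - κ`, `‖f(x q^l) - f(q^l)^x‖ ≤ 3tρ x` for all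
`x ≤ q`. [cite: Konieczny2020, Proposition 7.1] -/
theorem approx_pow {q r : ℕ} (hq : 2 ≤ q) {f : ℕ → ℂ} (hf : IsSemimultiplicative q r f)
    (hf1 : ∀ n, ‖f n‖ = 1) {p p' t B A ℓ : ℕ} (hp'p : p' < p) (hp'0 : 0 < p')
    (hcop : Nat.Coprime q p) (hB : p < q ^ B) (ht0 : 0 < t) (ht : q ^ (B + r) * p' ^ t < p ^ t)
    {ρ : ℝ} (Hρ : ∀ n, q ^ A ∣ n → n < q ^ (A + ℓ) → ‖f (p * n) - f (p' * n)‖ ≤ ρ)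
    (hℓ : 2 * (r + t * B) ≤ ℓ) {l : ℕ} (hl : A + (r + t * B) ≤ l)
    (hl2 : l + 2 ≤ A + ℓ - (r + t * B)) :
    ∀ x : ℕ, x ≤ q → ‖f (x * q ^ l) - f (q ^ l) ^ x‖ ≤ 3 * t * ρ * x := by
  have hqpos : 0 < q := by omega
  have hB1 : 1 ≤ B := by
    rcases Nat.eq_zero_or_pos B with h | h
    · subst h; simp at hB; omega
    · exact h
  intro x
  induction x with
  | zero => intro _; simp [hf.1]
  | succ x ih =>
      intro hx
      have hx' : x ≤ q := by omega
      have hxq : (x + 1) * q ^ l ≤ q ^ (l + 1) := by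
        rw [pow_succ, mul_comm (q ^ l)]; exact Nat.mul_le_mul_right _ hx
      have hql2 : q ^ (l + 1) < q ^ (A + ℓ - (r + t * B)) := Nat.pow_lt_pow_right (by omega) (by omega)
      have h := approx_mul hq hf hf1 hp'p hp'0 hcop hB ht0 ht Hρ hℓ (n := x * q ^ l) (m := q ^ l)
        (l := l) hl (by omega) (dvd_mul_left _ _)
        (by have : x * q ^ l ≤ (x + 1) * q ^ l := Nat.mul_le_mul_right _ (Nat.le_succ x); omega)
        (pow_dvd_pow q hl) (Nat.pow_lt_pow_right (by omega) (by omega))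
        (by rw [show x * q ^ l + q ^ l = (x + 1) * q ^ l by ring]; omega)
      rw [show x * q ^ l + q ^ l = (x + 1) * q ^ l by ring] at h
      calc ‖f ((x + 1) * q ^ l) - f (q ^ l) ^ (x + 1)‖
          ≤ ‖f ((x + 1) * q ^ l) - f (x * q ^ l) * f (q ^ l)‖ +
              ‖f (x * q ^ l) * f (q ^ l) - f (q ^ l) ^ (x + 1)‖ := norm_sub_le_norm_sub_add_norm_sub _ _ _
        _ ≤ 3 * t * ρ + 3 * t * ρ * x := by
            refine add_le_add h ?_
            rw [pow_succ, ← sub_mul, norm_mul, hf1, mul_one]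
            exact ih hx'
        _ = 3 * t * ρ * (x + 1 : ℕ) := by push_cast; ring

/-- **The character `n ↦ w^n`** (eqs. (19:98), (19:97) of Konieczny 2020): under the hypotheses
of `approx_mul`, let `w` be unimodular with `‖f(q^l) - w^{q^l}‖ ≤ 12 t q ρ` for all
`A + κ ≤ l ≤ A + ℓ - κ - 2` (as provided by the shadowing lemma).  Then for every `n` supported
on `len` consecutive positions `[a, a + len) ⊆ [A + κ, A + ℓ - κ - 1)`,
`‖f(n) - w^n‖ ≤ 18 t q² · len · ρ`. [cite: Konieczny2020, Proposition 7.1] -/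
theorem approx_char {q r : ℕ} (hq : 2 ≤ q) {f : ℕ → ℂ} (hf : IsSemimultiplicative q r f)
    (hf1 : ∀ n, ‖f n‖ = 1) {p p' t B A ℓ : ℕ} (hp'p : p' < p) (hp'0 : 0 < p')
    (hcop : Nat.Coprime q p) (hB : p < q ^ B) (ht0 : 0 < t) (ht : q ^ (B + r) * p' ^ t < p ^ t)
    {ρ : ℝ} (hρ : 0 ≤ ρ) (Hρ : ∀ n, q ^ A ∣ n → n < q ^ (A + ℓ) → ‖f (p * n) - f (p' * n)‖ ≤ ρ)
    (hℓ : 2 * (r + t * B) ≤ ℓ) {w : ℂ} (hw : ‖w‖ = 1)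
    (hθ : ∀ l, A + (r + t * B) ≤ l → l + 2 ≤ A + ℓ - (r + t * B) → ‖f (q ^ l) - w ^ q ^ l‖ ≤ 12 * t * q * ρ) :
    ∀ len a n : ℕ, A + (r + t * B) ≤ a → a + len + 2 ≤ A + ℓ - (r + t * B) → q ^ a ∣ n →
      n < q ^ (a + len) → ‖f n - w ^ n‖ ≤ 18 * t * q ^ 2 * len * ρ := by
  have hqpos : 0 < q := by omega
  have hqr : (1 : ℝ) ≤ q := by exact_mod_cast hqpos
  have hw1 : ‖w‖ ≤ 1 := hw.le
  intro len
  induction len with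
  | zero =>
      intro a n _ _ hdvd hlt
      rw [add_zero] at hlt
      have : n = 0 := Nat.eq_zero_of_dvd_of_lt hdvd hlt
      subst this
      simp [hf.1]
  | succ len ih =>
      intro a n ha hlen hdvd hlt
      -- top digit `d` at position `a + len`, remainder `n'`
      set P := a + len with hP
      set d := n / q ^ P with hd
      set n' := n % q ^ P with hn'
      have hndec : n = d * q ^ P + n' := (Nat.div_add_mod' n (q ^ P)).symm
      have hdq : d < q := by
        rw [hd, Nat.div_lt_iff_lt_mul (pow_pos hqpos P)]
        rw [← pow_succ']; rwa [hP, show a + len + 1 = a + (len + 1) by ring]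
      have hn'lt : n' < q ^ P := Nat.mod_lt _ (pow_pos hqpos P)
      have hn'dvd : q ^ a ∣ n' := by
        rw [hn']; exact (Nat.dvd_mod_iff (pow_dvd_pow q (by omega))).2 hdvd
      have hAκn' : q ^ (A + (r + t * B)) ∣ n' := dvd_trans (pow_dvd_pow q ha) hn'dvd
      -- Lemma 7.2 for `d q^P + n'`
      have hP2 : P + 2 ≤ A + ℓ - (r + t * B) := by omega
      have hdqP : d * q ^ P < q ^ (P + 1) := by
        rw [pow_succ, mul_comm (q ^ P)]; exact Nat.mul_lt_mul_of_pos_right hdq (pow_pos hqpos P)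
      have hqP1 : q ^ (P + 1) < q ^ (A + ℓ - (r + t * B)) := Nat.pow_lt_pow_right (by omega) (by omega)
      have hB1 : 1 ≤ B := by
        rcases Nat.eq_zero_or_pos B with h | h
        · subst h; simp at hB; omega
        · exact h
      have hmul := approx_mul hq hf hf1 hp'p hp'0 hcop hB ht0 ht Hρ hℓ (n := d * q ^ P) (m := n')
        (l := P) (by omega) (by omega) (dvd_mul_left _ _) (by omega) hAκn'
        (lt_of_lt_of_le hn'lt (Nat.pow_le_pow_right hqpos (by omega)))
        (by rw [← hndec]; calc n < q ^ (a + (len + 1)) := hlt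
              _ = q ^ (P + 1) := by rw [hP]; ring_nf
              _ < _ := hqP1)
      rw [← hndec] at hmul
      -- the top digit: `f(d q^P) ≈ f(q^P)^d ≈ w^{d q^P}`
      have hpowd := approx_pow hq hf hf1 hp'p hp'0 hcop hB ht0 ht Hρ hℓ (l := P) (by omega) hP2 d hdq.le
      have hθP := hθ P (by omega) hP2
      have hdr : (d : ℝ) ≤ q := by exact_mod_cast hdq.le
      have htop : ‖f (d * q ^ P) - w ^ (d * q ^ P)‖ ≤ 3 * t * ρ * q + 12 * t * q * ρ * q := by
        calc ‖f (d * q ^ P) - w ^ (d * q ^ P)‖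
            ≤ ‖f (d * q ^ P) - f (q ^ P) ^ d‖ + ‖f (q ^ P) ^ d - w ^ (d * q ^ P)‖ :=
              norm_sub_le_norm_sub_add_norm_sub _ _ _
          _ ≤ 3 * t * ρ * d + d * (12 * t * q * ρ) := by
              refine add_le_add hpowd ?_
              rw [mul_comm d, pow_mul]
              exact (norm_pow_sub_pow_le (hf1 _).le (by rw [norm_pow, hw, one_pow]) d).trans
                (mul_le_mul_of_nonneg_left hθP (Nat.cast_nonneg d))
          _ ≤ 3 * t * ρ * q + 12 * t * q * ρ * q := by
              have h1 : 0 ≤ 3 * t * ρ := by positivity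
              have h2 : 0 ≤ 12 * t * q * ρ := by positivity
              nlinarith
      -- the remainder by induction
      have hrest := ih a n' ha (by omega) hn'dvd hn'lt
      -- combine
      have hwn : w ^ n = w ^ (d * q ^ P) * w ^ n' := by rw [← pow_add, ← hndec]
      calc ‖f n - w ^ n‖ ≤ ‖f n - f (d * q ^ P) * f n'‖ + ‖f (d * q ^ P) * f n' - w ^ n‖ :=
            norm_sub_le_norm_sub_add_norm_sub _ _ _
        _ ≤ 3 * t * ρ + ((3 * t * ρ * q + 12 * t * q * ρ * q) + 18 * t * q ^ 2 * len * ρ) := by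
            refine add_le_add hmul ?_
            rw [hwn]
            exact (norm_mul_sub_mul_le (hf1 _).le (by rw [norm_pow, hw, one_pow])).trans
              (add_le_add htop hrest)
        _ ≤ 18 * t * q ^ 2 * (len + 1 : ℕ) * ρ := by
            push_cast
            have h1 : (0 : ℝ) ≤ t * ρ := by positivity
            have h2 : (3 : ℝ) + 3 * q ≤ 6 * q ^ 2 := by nlinarith [hqr]
            have h3 := mul_le_mul_of_nonneg_left h2 h1
            nlinarith [h3]

end Konieczny

end Literature.NumberTheory.LFunctions
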